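import Summits.QuantumFields.BalabanUV.Beta.FP.GhostLoopCountingMixRate
import Summits.QuantumFields.BalabanUV.Beta.FP.FineSplitJunctionTwoLeg

/-!
# `Beta/FP/GhostMixTwoLeg` — road «FP» (binder row D1), row KER-γ (α2) sub-row **α2-c** «GHOST», THE (MIX-2) GHOST WORD IN THE JUNCTION's TWO-LEG CURRENCY
# (ruling R-FP-36 (b): every near piece owes, PER `(c, e)` ENTRY, its POINTWISE majorant `M₁ b·M₂ b′·E₀·e^{−(2δ∕N)‖b′−b‖∞}` + the two mass letters of
# `FineSplitJunctionTwoLeg.coarse_secondMoment_abs_twoLeg` ∕ `rem_of_twoLeg` (F, p251473) — NOT a one-leg second-moment END)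

HONEST DEPENDENCY (page 1, mandatory): continuum YM on T⁴ ⇐ BetaPertH ∧ nine spine estimates (0/9 proved); BetaPertH ⇐ (D1) ∧ (D4) ∧
CAP+tail; G-an2-4 gates asym, D1 and NE2/3/4.  HONEST FRAMING (cell contract, verbatim): «discharging `BetaPertH` makes Bałaban's UV
stability UNCONDITIONAL — a real constructive-QFT result; it is NOT the continuum limit and NOT the Clay problem.»  THIS MODULE is [folklore] lattice
bookkeeping on `ℤ⁴` BY NAME over `MixLoopPowerCountingMass.abs_smearedLeg_le_radius` (one smeared leg against the radius letters), `ScalarAveragingJetLetters`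
(the 0-form rooted block family and its windowed mass letter `scl_windowedMass_le_half`, GENERIC in the letter type — here BOND letters `Pt × Fin 4` with position
`Prod.fst`), `GhostLoopCountingMixRate.ghostColumn_engineLetters_of_le` (the (I-gh) letters of the scalar minimiser `kerH (N−1) a` at any rate `≤ deltaH 4 1`) and
F's two-leg core.  It asserts nothing about Bałaban's constrained objects, cites nothing, mints no `Prop` fact, has no `def`, 0 sorry.  NOT α2-c PART 2 (the near
identity), NOT the instance numbers of (LEDGER-gh), NOT hsplit, NOT D1, NOT BetaPertH, NOT continuum, NOT Clay.

ABSOLUTE RULE (cell charter, verbatim): «No internally-minted statement may enter as a cited fact. Every hypothesis is either kernel-proved in this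
package or a verbatim quotation of a PUBLISHED theorem with page reference. The manuscript(s) under audit are NOT citable for their own disputed
steps — they are the thing under adjudication; programme-internal (2001/route/tribunal) claims are never citable.»

WHY (precision on my own lineage, E-d1leaf05g15-2): the (MIX-2) ghost word's `(c, e)` table entry has its FIRST vertex on a `c`-bond at `b` and its SECOND on an
`e`-bond at `b′` — two DIFFERENT vertex kernels — and the junction reads it against two DIFFERENT outer columns (`(c, μ)` at anchor `0`, `(e, ν)` running;
N-d1leaf01g11-2); the one-family, one-leg statements (`abs_mix2_le_mass`, `coarse_mix2_secondMoment_scl`, my `ghost_mix2_rem(_col)`) are true but do not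
serve the ledger.  This file re-keys the pointwise shape with TWO vertex families and TWO inner legs (§1), models the bond structure faithfully by the 0-form
rooted family with BOND letters `rad : σ → Pt → Pt → List (Pt × Fin 4)` (the averaging paths as bond words; the `c`-entry's vertex kernel at site `b` is
`ker₁ … (b, c) ·`) and proves its windowed mass letter (§2), and delivers the (hk) ∧ (M) pair of the ghost (MIX-2) word with inner leg `kerH (N−1) a`,
RATE-FREE DOWNWARD `δ ∈ (0, deltaH 4 1]` (§3), with the by-name check that the pair IS the input of F's core for ANY two outer legs (§4).

CONTENT ([folklore]): §1 **`abs_mix2_twoLeg_le_mass`**; §2 **`windowedMass_bond_le`**; §3 **`ghost_mix2_twoLeg`** ((hk) ∧ (M)); §4 **`ghost_mix2_secondMoment_twoLeg`**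
(F's `coarse_secondMoment_abs_twoLeg` at the pair, abstract outer legs `J₁`, `J₂` with (J)(J′)).
Provenance: D1 formalisation swarm LEAF PROVER 05, unit `b2b-balaban-beta-d1-formalise-leaf-05` gen 15, 2026-08-21, road FP row KER-γ (α2) sub-row α2-c (owner GO
R-FP-35 (a), words l.28227; R-FP-36 (b)); «not in print; our bookkeeping»; no existing file touched.
-/

noncomputable section

namespace Summit.QuantumFields.BalabanUV.Beta.FP.GhostMixTwoLeg

open Finset Real
open scoped BigOperators
open Literature.MathematicalPhysics.QuantumFieldTheory.Balaban1983to89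
open Literature.MathematicalPhysics.QuantumFieldTheory.Balaban1983to89.Beta
open DyadicShell (Pt supNorm)
open GradedBubbles (supNorm_neg)
open AxialBlockWeights (fineBlock mem_fineBlock)
open B5Hk103ScalarZd (kerH deltaH deltaH_pos)
open Summit.QuantumFields.BalabanUV.Beta.FP.AveragingJetLettersRooted (ker₁ mass₁ ker₁_nonneg mass₁_nonneg sum_ker₁_le_mass₁)
open Summit.QuantumFields.BalabanUV.Beta.FP.ScalarAveragingJetLetters
open Summit.QuantumFields.BalabanUV.Beta.FP.MixLoopPowerCountingMass (abs_smearedLeg_le_radius)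
open Summit.QuantumFields.BalabanUV.Beta.FP.GhostLoopCountingMixRate (ghostColumn_engineLetters_of_le)
open Summit.QuantumFields.BalabanUV.Beta.FP.FineSplitJunctionTwoLeg (coarse_secondMoment_abs_twoLeg)

/-! ## §1 The (MIX-2) pointwise shape with two vertex families and two inner legs -/

section Abstract

variable {U : Pt → Finset Pt} {W : Finset Pt} {qd₁ qd₂ : Pt → Pt → Pt → ℝ} {I₁ I₂ : Pt → Pt → ℝ} {C₁ C₂ δ : ℝ} {n R : ℕ}

/-- **(MIX-2) POINTWISE SHAPE, TWO VERTEX FAMILIES, TWO INNER LEGS** [folklore]: under the radius letters (U) `u ∈ U b ⟹ ‖b − n•u‖∞ ≤ R·n`, (W) `‖w‖∞ ≤ R·n`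
and the inner-leg letters (I₁) `|I₁ c u| ≤ C₁·e^{−(δ∕n)‖c − n•u‖∞}`, (I₂) likewise with `C₂`, for every `b`, `b′`:
`|Σ_{u∈U b}Σ_{u′∈U b′}(Σ_{w∈W} q̇₁(u;b,b+w)·I₁(b+w,u′))·(Σ_{w′∈W} q̇₂(u′;b′,b′+w′)·I₂(b′+w′,u))| ≤ M₁(b)·M₂(b′)·((C₁e^{2Rδ})·(C₂e^{2Rδ}))·e^{−(2δ∕n)‖b′−b‖∞}`,
`M_i(b) := Σ_{u∈U b}Σ_{w∈W}|q̇_i(u;b,b+w)|` — VERBATIM the (hk) binder of `FineSplitJunctionTwoLeg.coarse_secondMoment_abs_twoLeg`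
(`MixLoopPowerCountingMass.abs_mix2_le_mass` is the case `q̇₁ = q̇₂`, `I₁ = I₂`; proof = `abs_smearedLeg_le_radius` once per leg). -/
theorem abs_mix2_twoLeg_le_mass (hδ : 0 < δ) (hn : 1 ≤ n) (hU : ∀ b, ∀ u ∈ U b, supNorm (b - (n : ℤ) • u) ≤ R * n)
    (hW : ∀ w ∈ W, supNorm w ≤ R * n)
    (hI₁ : ∀ c u, |I₁ c u| ≤ C₁ * Real.exp (-(δ / n) * (supNorm (c - (n : ℤ) • u) : ℝ)))
    (hI₂ : ∀ c u, |I₂ c u| ≤ C₂ * Real.exp (-(δ / n) * (supNorm (c - (n : ℤ) • u) : ℝ))) (b b' : Pt) :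
    |∑ u ∈ U b, ∑ u' ∈ U b', (∑ w ∈ W, qd₁ u b (b + w) * I₁ (b + w) u') * (∑ w' ∈ W, qd₂ u' b' (b' + w') * I₂ (b' + w') u)|
      ≤ (∑ u ∈ U b, ∑ w ∈ W, |qd₁ u b (b + w)|) * (∑ u' ∈ U b', ∑ w' ∈ W, |qd₂ u' b' (b' + w')|)
          * ((C₁ * Real.exp (2 * R * δ)) * (C₂ * Real.exp (2 * R * δ))) * Real.exp (-(2 * δ / n) * (supNorm (b' - b) : ℝ)) := by
  set e₀ : ℝ := Real.exp (-(δ / n) * (supNorm (b' - b) : ℝ)) with he₀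
  set E₁ : ℝ := C₁ * Real.exp (2 * R * δ) * e₀ with hE₁
  set E₂ : ℝ := C₂ * Real.exp (2 * R * δ) * e₀ with hE₂
  have hC₁ : 0 ≤ C₁ := by
    have h := hI₁ b b
    have : 0 < Real.exp (-(δ / n) * (supNorm (b - (n : ℤ) • b) : ℝ)) := Real.exp_pos _
    nlinarith [abs_nonneg (I₁ b b)]
  have hE₁0 : 0 ≤ E₁ := by positivity
  set m₁ : Pt → Pt → ℝ := fun b u => ∑ w ∈ W, |qd₁ u b (b + w)| with hm₁
  set m₂ : Pt → Pt → ℝ := fun b u => ∑ w ∈ W, |qd₂ u b (b + w)| with hm₂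
  have hm₁0 : ∀ b u, 0 ≤ m₁ b u := fun b u => Finset.sum_nonneg fun w _ => abs_nonneg _
  have hX : ∀ u, ∀ u' ∈ U b', |∑ w ∈ W, qd₁ u b (b + w) * I₁ (b + w) u'| ≤ m₁ b u * E₁ :=
    fun u u' hu' => abs_smearedLeg_le_radius (qd := qd₁) hδ hn hW hI₁ (hU b' u' hu') u b
  have hY : ∀ u ∈ U b, ∀ u', |∑ w' ∈ W, qd₂ u' b' (b' + w') * I₂ (b' + w') u| ≤ m₂ b' u' * E₂ := by
    intro u hu u'
    have h := abs_smearedLeg_le_radius (qd := qd₂) hδ hn hW hI₂ (hU b u hu) u' b'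
    have e : (supNorm (b - b') : ℝ) = supNorm (b' - b) := by rw [← supNorm_neg, neg_sub]
    rwa [e] at h
  calc |∑ u ∈ U b, ∑ u' ∈ U b', (∑ w ∈ W, qd₁ u b (b + w) * I₁ (b + w) u') * (∑ w' ∈ W, qd₂ u' b' (b' + w') * I₂ (b' + w') u)|
      ≤ ∑ u ∈ U b, ∑ u' ∈ U b', (m₁ b u * E₁) * (m₂ b' u' * E₂) := by
        refine (Finset.abs_sum_le_sum_abs _ _).trans (Finset.sum_le_sum fun u hu =>
          (Finset.abs_sum_le_sum_abs _ _).trans (Finset.sum_le_sum fun u' hu' => ?_))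
        rw [abs_mul]
        exact mul_le_mul (hX u u' hu') (hY u hu u') (abs_nonneg _) (mul_nonneg (hm₁0 b u) hE₁0)
    _ = (E₁ * E₂) * ((∑ u ∈ U b, m₁ b u) * (∑ u' ∈ U b', m₂ b' u')) := by
        rw [Finset.sum_mul_sum, Finset.mul_sum]
        refine Finset.sum_congr rfl fun u _ => ?_
        rw [Finset.mul_sum]
        exact Finset.sum_congr rfl fun u' _ => by ring
    _ = (∑ u ∈ U b, m₁ b u) * (∑ u' ∈ U b', m₂ b' u')
          * ((C₁ * Real.exp (2 * R * δ)) * (C₂ * Real.exp (2 * R * δ))) * Real.exp (-(2 * δ / n) * (supNorm (b' - b) : ℝ)) := by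
        have e2 : Real.exp (-(2 * δ / n) * (supNorm (b' - b) : ℝ)) = e₀ * e₀ := by
          rw [he₀, ← Real.exp_add]; congr 1; ring
        rw [e2, hE₁, hE₂]; ring

end Abstract

/-! ## §2 The 0-form rooted family with BOND letters: the windowed mass letter of the direction-`c` vertex kernel -/

section Bond

variable {σ : Type*} [Fintype σ] {N : ℕ} {p : σ → ℝ} {rad : σ → Pt → Pt → List (Pt × Fin 4)} {ℓ₀ R₀ : ℕ}

/-- **(M) FOR THE DIRECTION-`c` VERTEX MASS `M_c(b) = Σ_{u∈U b}Σ_{w∈W}|ker₁^{(u)} (b, c) (b+w)|` OF THE 0-FORM FAMILY WITH BOND LETTERS** ([folklore]; ANY coarse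
windows `U b`, ANY finite offset window `W`, every fine window `A`, every centre `q`, every direction `c`):
`Σ_{b∈A} e^{−(δ∕(2N))‖b−q‖∞}·M_c(b) ≤ (ℓ₀·Σ_σ p σ)·e^{δR₀∕2}·(e^{δ∕2}(1+480e^{δ∕4}(4∕δ)⁴))` — `Σ_{w∈W} ker₁^{(u)} (b,c) (b+w) ≤ mass₁^{(u)} (b,c)` (`sum_ker₁_le_mass₁`
on the translated window), `U b ⊆ A.biUnion U`, then `ScalarAveragingJetLetters.scl_windowedMass_le_half` BY NAME at the letter type `Pt × Fin 4`, position `Prod.fst`,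
on the bond window `A × {c}`.  The radius letter is on the POSITION of the bond letters: `ℓ ∈ rad σ u x′ ⟹ ‖ℓ.1 − N•u‖∞ ≤ R₀N`. -/
theorem windowedMass_bond_le {δ : ℝ} (hδ : 0 < δ) (hN : 1 ≤ N) (hp : ∀ s, 0 ≤ p s)
    (hrad : ∀ s u x', (rad s u x').length ≤ ℓ₀)
    (hradR : ∀ (s : σ) (u : Pt) (x : ↥(fineBlock N)) (ℓ : Pt × Fin 4), ℓ ∈ rad s u x.1 → supNorm (ℓ.1 - (N : ℤ) • u) ≤ R₀ * N)
    (U : Pt → Finset Pt) (W A : Finset Pt) (c : Fin 4) (q : Pt) :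
    ∑ b ∈ A, Real.exp (-(δ / (2 * N)) * (supNorm (b - q) : ℝ)) *
        (∑ u ∈ U b, ∑ w ∈ W, |ker₁ (sclW N p) (sclFld N u) (sclBg N u rad) (b, c) (b + w)|)
      ≤ (((ℓ₀ : ℕ) : ℝ) * ∑ s, p s) * Real.exp (δ * R₀ / 2) *
          (Real.exp (δ / 2) * (1 + 480 * Real.exp (δ / 4) * (4 / δ) ^ 4)) := by
  classical
  set Y : Finset Pt := A.biUnion U with hY
  have hω := sclW_nonneg N hp
  -- the inner mass is at most the windowed family mass of the bond letter `(b, c)` over `Y`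
  have hinner : ∀ b ∈ A, ∑ u ∈ U b, ∑ w ∈ W, |ker₁ (sclW N p) (sclFld N u) (sclBg N u rad) (b, c) (b + w)|
      ≤ ∑ u ∈ Y, mass₁ (sclW N p) (sclBg N u rad) (b, c) := by
    intro b hb
    have hUb : U b ⊆ Y := by rw [hY]; exact Finset.subset_biUnion_of_mem U hb
    have hw : ∀ u, ∑ w ∈ W, |ker₁ (sclW N p) (sclFld N u) (sclBg N u rad) (b, c) (b + w)|
        ≤ mass₁ (sclW N p) (sclBg N u rad) (b, c) := by
      intro u
      have habs : ∀ w, |ker₁ (sclW N p) (sclFld N u) (sclBg N u rad) (b, c) (b + w)|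
          = ker₁ (sclW N p) (sclFld N u) (sclBg N u rad) (b, c) (b + w) := fun w => abs_of_nonneg (ker₁_nonneg hω _ _)
      simp only [habs]
      rw [← Finset.sum_image (s := W) (g := fun w => b + w)
        (f := fun c' => ker₁ (sclW N p) (sclFld N u) (sclBg N u rad) (b, c) c') (fun x _ y _ h => add_left_cancel h)]
      exact sum_ker₁_le_mass₁ hω _ (b, c)
    calc ∑ u ∈ U b, ∑ w ∈ W, |ker₁ (sclW N p) (sclFld N u) (sclBg N u rad) (b, c) (b + w)|
        ≤ ∑ u ∈ U b, mass₁ (sclW N p) (sclBg N u rad) (b, c) := Finset.sum_le_sum fun u _ => hw u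
      _ ≤ ∑ u ∈ Y, mass₁ (sclW N p) (sclBg N u rad) (b, c) :=
          Finset.sum_le_sum_of_subset_of_nonneg hUb fun u _ _ => mass₁_nonneg hω (b, c)
  have hradR' : ∀ (s : σ) (u : Pt) (x : ↥(fineBlock N)) (ℓ : Pt × Fin 4), ℓ ∈ rad s u x.1 →
      (supNorm (Prod.fst ℓ - (N : ℤ) • u) : ℝ) ≤ (R₀ : ℝ) * N := by
    intro s u x ℓ h
    exact_mod_cast hradR s u x ℓ h
  -- the bond window `A × {c}`
  have hM := scl_windowedMass_le_half (B := Pt × Fin 4) hδ hN hp hrad Prod.fst hradR'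
    (A.map ⟨fun b => (b, c), fun x y h => congrArg Prod.fst h⟩) Y q
  rw [Finset.sum_map] at hM
  calc ∑ b ∈ A, Real.exp (-(δ / (2 * N)) * (supNorm (b - q) : ℝ)) *
          (∑ u ∈ U b, ∑ w ∈ W, |ker₁ (sclW N p) (sclFld N u) (sclBg N u rad) (b, c) (b + w)|)
      ≤ ∑ b ∈ A, Real.exp (-(δ / (2 * N)) * (supNorm (b - q) : ℝ)) * ∑ u ∈ Y, mass₁ (sclW N p) (sclBg N u rad) (b, c) :=
        Finset.sum_le_sum fun b hb => mul_le_mul_of_nonneg_left (hinner b hb) (Real.exp_pos _).le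
    _ ≤ _ := by simpa using hM

end Bond

/-! ## §3 The ghost (MIX-2) word: the (hk) ∧ (M) pair, rate-free downward -/

section Ghost

/-- **`ghost_mix2_twoLeg` — THE GHOST (MIX-2) WORD IN THE TWO-LEG CURRENCY** ([our object]).  With the (I-gh) letter constant `Cg` of
`ghostColumn_engineLetters_of_le` and `δ₀ := deltaH 4 1`: for EVERY rate `δ ∈ (0, δ₀]`, `a > 0`, `N ≥ 1`, every 0-form rooted block family with BOND letters
(`p ≥ 0`, word length `≤ ℓ₀`, letters within `R₀N` of the root block), any coarse windows with (U) `u ∈ U b ⟹ ‖b − N•u‖∞ ≤ (R₀+1)N` and finite offsets with (W)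
`‖w‖∞ ≤ (R₀+1)N`:  (hk) for every `(c, e)` and every `b`, `b′`, the `(c, e)` entry of the word — first vertex the direction-`c` jet at `b`, second the direction-`e` jet
at `b′`, inner legs the scalar minimiser `kerH (N−1) a` — is bounded by `M_c(b)·M_e(b′)·(Cg·e^{2(R₀+1)δ})²·e^{−(2δ∕N)‖b′−b‖∞}`;  (M) for every direction `c`, centre `q`
and fine window `A`, `Σ_{b∈A} e^{−(δ∕(2N))‖b−q‖∞}·M_c(b) ≤ (ℓ₀·Σp)·e^{δR₀∕2}·(e^{δ∕2}(1+480e^{δ∕4}(4∕δ)⁴))`.  These are the (hk)(M₁)(M₂) binders of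
`FineSplitJunctionTwoLeg.coarse_secondMoment_abs_twoLeg` ∕ `rem_window_of_twoLeg` (`M₁ c e := M_c`, `M₂ c e := M_e`, one `E₀`); every power of `N` displayed (none). -/
theorem ghost_mix2_twoLeg :
    ∃ δ₀ Cg : ℝ, 0 < δ₀ ∧ 0 ≤ Cg ∧ ∀ δ : ℝ, 0 < δ → δ ≤ δ₀ → ∀ {a : ℝ}, 0 < a → ∀ (N : ℕ), 1 ≤ N →
      ∀ {σ : Type*} [Fintype σ] {p : σ → ℝ} (_ : ∀ s, 0 ≤ p s)
        {rad : σ → Pt → Pt → List (Pt × Fin 4)} {ℓ₀ R₀ : ℕ} (_ : ∀ s u x', (rad s u x').length ≤ ℓ₀)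
        (_ : ∀ (s : σ) (u : Pt) (x : ↥(fineBlock N)) (ℓ : Pt × Fin 4), ℓ ∈ rad s u x.1 → supNorm (ℓ.1 - (N : ℤ) • u) ≤ R₀ * N)
        {U : Pt → Finset Pt} (_ : ∀ b, ∀ u ∈ U b, supNorm (b - (N : ℤ) • u) ≤ (R₀ + 1) * N)
        {W : Finset Pt} (_ : ∀ w ∈ W, supNorm w ≤ (R₀ + 1) * N),
        (∀ (c e : Fin 4) (b b' : Pt),
          |∑ u ∈ U b, ∑ u' ∈ U b',
              (∑ w ∈ W, ker₁ (sclW N p) (sclFld N u) (sclBg N u rad) (b, c) (b + w) * kerH (N - 1) a (b + w) u') *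
              (∑ w' ∈ W, ker₁ (sclW N p) (sclFld N u') (sclBg N u' rad) (b', e) (b' + w') * kerH (N - 1) a (b' + w') u)|
            ≤ (∑ u ∈ U b, ∑ w ∈ W, |ker₁ (sclW N p) (sclFld N u) (sclBg N u rad) (b, c) (b + w)|) *
              (∑ u' ∈ U b', ∑ w' ∈ W, |ker₁ (sclW N p) (sclFld N u') (sclBg N u' rad) (b', e) (b' + w')|) *
              ((Cg * Real.exp (2 * ((R₀ : ℝ) + 1) * δ)) * (Cg * Real.exp (2 * ((R₀ : ℝ) + 1) * δ))) *
              Real.exp (-(2 * δ / N) * (supNorm (b' - b) : ℝ))) ∧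
        (∀ (c : Fin 4) (q : Pt) (A : Finset Pt),
          ∑ b ∈ A, Real.exp (-(δ / (2 * N)) * (supNorm (b - q) : ℝ)) *
              (∑ u ∈ U b, ∑ w ∈ W, |ker₁ (sclW N p) (sclFld N u) (sclBg N u rad) (b, c) (b + w)|)
            ≤ (((ℓ₀ : ℕ) : ℝ) * ∑ s, p s) * Real.exp (δ * R₀ / 2) *
                (Real.exp (δ / 2) * (1 + 480 * Real.exp (δ / 4) * (4 / δ) ^ 4))) := by
  obtain ⟨C, C', hC, _, h⟩ := ghostColumn_engineLetters_of_le
  refine ⟨deltaH 4 1, C, deltaH_pos 4 one_pos, hC, fun δ hδ hδle a ha N hN σ _ p hp rad ℓ₀ R₀ hrad hradR U hU W hW => ⟨?_, ?_⟩⟩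
  · intro c e b b'
    obtain ⟨hI, _⟩ := h δ hδ hδle ha N hN
    have hmain := abs_mix2_twoLeg_le_mass (n := N) (R := R₀ + 1) (U := U) (W := W)
      (qd₁ := fun u b x => ker₁ (sclW N p) (sclFld N u) (sclBg N u rad) (b, c) x)
      (qd₂ := fun u b x => ker₁ (sclW N p) (sclFld N u) (sclBg N u rad) (b, e) x)
      (I₁ := fun x u => kerH (N - 1) a x u) (I₂ := fun x u => kerH (N - 1) a x u) hδ hN hU hW hI hI b b'
    have e1 : (((R₀ + 1 : ℕ) : ℝ)) = (R₀ : ℝ) + 1 := by push_cast; ring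
    rw [e1] at hmain
    exact hmain
  · intro c q A
    exact windowedMass_bond_le hδ hN hp hrad hradR U W A c q

/-! ## §4 The by-name junction check: the pair IS the input of F's two-leg core, for ANY two outer legs -/

/-- **`ghost_mix2_secondMoment_twoLeg` — THE GHOST (MIX-2) WORD THROUGH F's TWO-LEG CORE** ([our object]; `FineSplitJunctionTwoLeg.coarse_secondMoment_abs_twoLeg`
BY NAME at §3's pair): with `(δ₀, Cg)` of `ghost_mix2_twoLeg`, for every rate `δ ∈ (0, δ₀]`, `a > 0`, `N ≥ 1`, family, windows as there, every `(c, e)`, and ANY two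
outer legs — a reference leg `J₁` with (J) `|J₁ b| ≤ C_J·e^{−(δ∕N)‖b − N•v₀‖∞}` and a running leg `J₂` with (J′) `Σ_{v∈V}(1+(‖b′−N•v‖∞∕N)²)|J₂ b′ v| ≤ C_J′` (on the
road: the END columns of two DIFFERENT fibre pairs) — and all finite `S`, `V`:
`Σ_{v∈V}‖v−v₀‖∞²·Σ_{b,b′∈S}|J₁ b|·|J₂ b′ v|·|k₂^{gh,(c,e)}(b,b′)| ≤ 3·(1+20∕δ²)·(Cg·e^{2(R₀+1)δ})²·C_J·C_J′·A_M²`, `A_M = (ℓ₀·Σp)·e^{δR₀∕2}·(e^{δ∕2}(1+480e^{δ∕4}(4∕δ)⁴))`. -/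
theorem ghost_mix2_secondMoment_twoLeg :
    ∃ δ₀ Cg : ℝ, 0 < δ₀ ∧ 0 ≤ Cg ∧ ∀ δ : ℝ, 0 < δ → δ ≤ δ₀ → ∀ {a : ℝ}, 0 < a → ∀ (N : ℕ), 1 ≤ N →
      ∀ {σ : Type*} [Fintype σ] {p : σ → ℝ} (_ : ∀ s, 0 ≤ p s)
        {rad : σ → Pt → Pt → List (Pt × Fin 4)} {ℓ₀ R₀ : ℕ} (_ : ∀ s u x', (rad s u x').length ≤ ℓ₀)
        (_ : ∀ (s : σ) (u : Pt) (x : ↥(fineBlock N)) (ℓ : Pt × Fin 4), ℓ ∈ rad s u x.1 → supNorm (ℓ.1 - (N : ℤ) • u) ≤ R₀ * N)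
        {U : Pt → Finset Pt} (_ : ∀ b, ∀ u ∈ U b, supNorm (b - (N : ℤ) • u) ≤ (R₀ + 1) * N)
        {W : Finset Pt} (_ : ∀ w ∈ W, supNorm w ≤ (R₀ + 1) * N) (c e : Fin 4)
        {J₁ : Pt → ℝ} {J₂ : Pt → Pt → ℝ} {C_J C_J' : ℝ} (S V : Finset Pt) (v₀ : Pt)
        (_ : ∀ b, |J₁ b| ≤ C_J * Real.exp (-(δ / N) * (supNorm (b - (N : ℤ) • v₀) : ℝ)))
        (_ : ∀ b', ∑ v ∈ V, (1 + ((supNorm (b' - (N : ℤ) • v) : ℝ) / N) ^ 2) * |J₂ b' v| ≤ C_J'),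
        ∑ v ∈ V, (supNorm (v - v₀) : ℝ) ^ 2 * ∑ b ∈ S, ∑ b' ∈ S, |J₁ b| * |J₂ b' v| *
            |∑ u ∈ U b, ∑ u' ∈ U b',
              (∑ w ∈ W, ker₁ (sclW N p) (sclFld N u) (sclBg N u rad) (b, c) (b + w) * kerH (N - 1) a (b + w) u') *
              (∑ w' ∈ W, ker₁ (sclW N p) (sclFld N u') (sclBg N u' rad) (b', e) (b' + w') * kerH (N - 1) a (b' + w') u)|
          ≤ 3 * (1 + 20 / δ ^ 2) * ((Cg * Real.exp (2 * ((R₀ : ℝ) + 1) * δ)) * (Cg * Real.exp (2 * ((R₀ : ℝ) + 1) * δ))) * C_J * C_J' *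
              ((((ℓ₀ : ℕ) : ℝ) * ∑ s, p s) * Real.exp (δ * R₀ / 2) * (Real.exp (δ / 2) * (1 + 480 * Real.exp (δ / 4) * (4 / δ) ^ 4))) *
              ((((ℓ₀ : ℕ) : ℝ) * ∑ s, p s) * Real.exp (δ * R₀ / 2) * (Real.exp (δ / 2) * (1 + 480 * Real.exp (δ / 4) * (4 / δ) ^ 4))) := by
  obtain ⟨δ₀, Cg, hδ₀, hCg, h⟩ := ghost_mix2_twoLeg
  refine ⟨δ₀, Cg, hδ₀, hCg, fun δ hδ hδle a ha N hN σ _ p hp rad ℓ₀ R₀ hrad hradR U hU W hW c e J₁ J₂ C_J C_J' S V v₀ hJ hJ' => ?_⟩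
  obtain ⟨hk, hM⟩ := h δ hδ hδle ha N hN hp hrad hradR hU hW
  have hE₀ : 0 ≤ (Cg * Real.exp (2 * ((R₀ : ℝ) + 1) * δ)) * (Cg * Real.exp (2 * ((R₀ : ℝ) + 1) * δ)) := by positivity
  exact coarse_secondMoment_abs_twoLeg (n := N) (S := S) (V := V) (v₀ := v₀) (J₁ := J₁) (J₂ := J₂)
    (M₁ := fun b => ∑ u ∈ U b, ∑ w ∈ W, |ker₁ (sclW N p) (sclFld N u) (sclBg N u rad) (b, c) (b + w)|)
    (M₂ := fun b' => ∑ u' ∈ U b', ∑ w' ∈ W, |ker₁ (sclW N p) (sclFld N u') (sclBg N u' rad) (b', e) (b' + w')|)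
    hδ hN hE₀ (fun b => Finset.sum_nonneg fun _ _ => Finset.sum_nonneg fun _ _ => abs_nonneg _)
    (fun b' => Finset.sum_nonneg fun _ _ => Finset.sum_nonneg fun _ _ => abs_nonneg _)
    hJ hJ' (fun b b' => hk c e b b') (hM c ((N : ℤ) • v₀) S) (fun q => hM e q S)

end Ghost

end Summit.QuantumFields.BalabanUV.Beta.FP.GhostMixTwoLeg

end
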